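import Mathlib
import Summits.Ventures.PercRepro2.Defs
import Summits.Ventures.PercRepro2.Graph
import Summits.Ventures.PercRepro2.Events
import Summits.Ventures.PercRepro2.Harris
import Summits.Ventures.PercRepro2.HCov
import Summits.Ventures.PercRepro2.PendantRoot
import Summits.Ventures.PercRepro2.HCovDiag
import Summits.Ventures.PercRepro2.PendantOB

/-!
# (HCOV) when `b` is a leaf at `o` (blind cell PercRepro2, mine-2 g14; MINE2-CUTVERTEX.md §13.23)

The mirror of `PendantOB`: with `b` a leaf attached to `o` by the edge `f` of weight `q = p f`,
every `b`-mass of `Gc` is `q` times the corresponding mass with `b := o`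
(`{x ↔ b} = {f open} ∩ {x ↔ o}`, `PendantRoot.connEvent_other_leaf`, and `{f open}` is independent
of the `b`-free events), and `Gc` is linear in the `b`-masses (`EQbo`, `EQb3`, `EQb3o`, `gap`,
`PDb`, `PDbo`); hence `Gc(b leaf at o) = q · Gc(b := o)` (`Gc_pendant_b_at_o`) and (HCOV) follows
from the diagonal theorem `HCovDiag.Gc_diag_nonneg` for every leaf weight (`HCov_pendant_b_at_o`).
Together with `PendantOB` this closes the one-far-mark instances «`b` alone behind the cut vertex
`o`» and «`o` alone behind `b`» (LEAD-SEP3.md §3 table) by the exact identity of §13.22 / §13.23.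
-/

namespace Summit.Ventures.PercRepro2
namespace PendantBO

open CovForm PendantRoot

variable {V : Type*} {E : Type*} [Fintype E] [DecidableEq E] [DecidableEq V]
  {R : Type*} [Field R] [LinearOrder R] [IsStrictOrderedRing R]

omit [DecidableEq V] [LinearOrder R] [IsStrictOrderedRing R] in
/-- `P(W ∩ {x ↔ b}) = q · P(W ∩ {x ↔ o})` for `b` a leaf at `o` and `W` free of `f`. -/
lemma prob_leaf1 (p : E → R) {ends : E → Sym2 V} {f : E} {b o : V} (hf : ends f = s(b, o))
    (hleaf : ∀ e, b ∈ ends e → e = f) (hbo : b ≠ o) {x : V} (hx : b ≠ x) {W : Set (Config E)}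
    (hW : Free f W) :
    prob p (W ∩ connEvent ends x b) = p f * prob p (W ∩ connEvent ends x o) := by
  rw [connEvent_other_leaf hf hleaf hbo hx]
  have e : W ∩ (openEdge f ∩ connEvent ends x o) = (W ∩ connEvent ends x o) ∩ openEdge f := by
    ext ω; simp only [Set.mem_inter_iff]; tauto
  rw [e, prob_inter_openEdge_of_free p (hW.inter (free_connEvent hf hleaf hbo (Ne.symm hx) (Ne.symm hbo))),
    mul_comm]

omit [DecidableEq V] [LinearOrder R] [IsStrictOrderedRing R] in
/-- `P(W ∩ (Y ∩ {x ↔ b})) = q · P(W ∩ (Y ∩ {x ↔ o}))` for `W`, `Y` free of `f`. -/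
lemma prob_leaf2 (p : E → R) {ends : E → Sym2 V} {f : E} {b o : V} (hf : ends f = s(b, o))
    (hleaf : ∀ e, b ∈ ends e → e = f) (hbo : b ≠ o) {x : V} (hx : b ≠ x) {W Y : Set (Config E)}
    (hW : Free f W) (hY : Free f Y) :
    prob p (W ∩ (Y ∩ connEvent ends x b)) = p f * prob p (W ∩ (Y ∩ connEvent ends x o)) := by
  rw [connEvent_other_leaf hf hleaf hbo hx]
  have e : W ∩ (Y ∩ (openEdge f ∩ connEvent ends x o)) = (W ∩ (Y ∩ connEvent ends x o)) ∩ openEdge f := by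
    ext ω; simp only [Set.mem_inter_iff]; tauto
  rw [e, prob_inter_openEdge_of_free p
    (hW.inter (hY.inter (free_connEvent hf hleaf hbo (Ne.symm hx) (Ne.symm hbo)))), mul_comm]

omit [DecidableEq V] in
/-- **`Gc` with `b` a leaf at `o` is `q · Gc(b := o)`.** -/
theorem Gc_pendant_b_at_o (p : E → R) (ends : E → Sym2 V) {f : E} {b o : V} (hf : ends f = s(b, o))
    (hleaf : ∀ e, b ∈ ends e → e = f) (hbo : b ≠ o) {a₁ a₂ a₃ : V} (hb1 : b ≠ a₁) (hb2 : b ≠ a₂)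
    (hb3 : b ≠ a₃) :
    Gc p ends o a₁ a₂ a₃ b = p f * Gc p ends o a₁ a₂ a₃ o := by
  have c₁₂ := free_connEvent hf hleaf hbo (Ne.symm hb1) (Ne.symm hb2)
  have c₂₁ := free_connEvent hf hleaf hbo (Ne.symm hb2) (Ne.symm hb1)
  have c₁₃ := free_connEvent hf hleaf hbo (Ne.symm hb1) (Ne.symm hb3)
  have c₂₃ := free_connEvent hf hleaf hbo (Ne.symm hb2) (Ne.symm hb3)
  have c₃₁ := free_connEvent hf hleaf hbo (Ne.symm hb3) (Ne.symm hb1)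
  have c₃₂ := free_connEvent hf hleaf hbo (Ne.symm hb3) (Ne.symm hb2)
  have c₁o := free_connEvent hf hleaf hbo (Ne.symm hb1) (Ne.symm hbo)
  have c₂o := free_connEvent hf hleaf hbo (Ne.symm hb2) (Ne.symm hbo)
  have hQ : Free f (avoidAll ends a₂ {a₁}) := by
    rw [avoidAll_eq_compl]; exact c₁₂.compl
  have hT : Free f (TEvent ends a₁ a₂ a₃) := c₂₁.compl.inter c₂₃
  have hTp : Free f (TEvent ends a₂ a₁ a₃) := c₁₂.compl.inter c₁₃
  have hPD : Free f (PDEvent ends a₁ a₂ a₃) :=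
    c₁₂.compl.inter ((PendantOB.free_union c₃₁ c₃₂).compl)
  unfold Gc DEF CovForm.EQbo EQb3 EQb3o EQo EQ3 EQ3o PDb PDbo Do
  rw [gap_eq_Q p ends a₁ a₂ b, gap_eq_Q p ends a₁ a₂ o]
  simp only [
    prob_leaf1 p hf hleaf hbo hb1 hQ,
    prob_leaf2 p hf hleaf hbo hb1 hQ c₁o,
    prob_leaf2 p hf hleaf hbo hb1 hQ c₂o,
    prob_leaf1 p hf hleaf hbo hb2 hQ,
    prob_leaf2 p hf hleaf hbo hb2 hQ c₁o,
    prob_leaf2 p hf hleaf hbo hb2 hQ c₂o,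
    prob_leaf1 p hf hleaf hbo hb1 hPD,
    prob_leaf2 p hf hleaf hbo hb1 hPD c₁o,
    prob_leaf2 p hf hleaf hbo hb1 hPD c₂o,
    prob_leaf1 p hf hleaf hbo hb2 hPD,
    prob_leaf2 p hf hleaf hbo hb2 hPD c₁o,
    prob_leaf2 p hf hleaf hbo hb2 hPD c₂o,
    prob_leaf1 p hf hleaf hbo hb1 hT,
    prob_leaf2 p hf hleaf hbo hb1 hT c₁o,
    prob_leaf2 p hf hleaf hbo hb1 hT c₂o,
    prob_leaf1 p hf hleaf hbo hb2 hT,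
    prob_leaf2 p hf hleaf hbo hb2 hT c₁o,
    prob_leaf2 p hf hleaf hbo hb2 hT c₂o,
    prob_leaf1 p hf hleaf hbo hb1 hTp,
    prob_leaf2 p hf hleaf hbo hb1 hTp c₁o,
    prob_leaf2 p hf hleaf hbo hb1 hTp c₂o,
    prob_leaf1 p hf hleaf hbo hb2 hTp,
    prob_leaf2 p hf hleaf hbo hb2 hTp c₁o,
    prob_leaf2 p hf hleaf hbo hb2 hTp c₂o]
  ring

/-- **(HCOV) when `b` is a leaf at `o`**, for every leaf weight. -/
theorem HCov_pendant_b_at_o (p : E → R) (hp : IsProbVec p) (ends : E → Sym2 V) {f : E} {b o : V}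
    (hf : ends f = s(b, o)) (hleaf : ∀ e, b ∈ ends e → e = f) (hbo : b ≠ o) {a₁ a₂ a₃ : V}
    (hb1 : b ≠ a₁) (hb2 : b ≠ a₂) (hb3 : b ≠ a₃) : HCov p ends o a₁ a₂ a₃ b := by
  unfold HCov
  rw [Gc_pendant_b_at_o p ends hf hleaf hbo hb1 hb2 hb3]
  exact mul_nonneg (hp.nonneg f) (HCovDiag.Gc_diag_nonneg p hp ends a₁ a₂ a₃ o)

end PendantBO
end Summit.Ventures.PercRepro2
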